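import Summits.QuantumFields.YangMills.Theorems.UnitScaleTiltProp7PinnedKernelL1Explicit
import Summits.QuantumFields.YangMills.Theorems.UnitScaleTiltProp7PinnedKernelL1Arith
import Summits.QuantumFields.YangMills.Theorems.UnitScaleTiltProp7TorusGreen2GradientBound
import HarnessLib

/-!
# Route `UnitScaleTilt`, crux K1 «MinimiserStabilityRegPr» (stmt-QuantumFields-19200), route-R E′ path (α′), residue (hK) = S2's supplier, assembly (A), file (F-b, part 2 of 2):
# ★★★ THE KERNEL BOUND (hK): `Σ_z|K(b,z)| ≤ c_I·ℓ` — on the finest torus `Site P 0` (`d = 3`, `1 ≤ k ≤ m+K`, `ℓ = L^k`, lattice factor `c ≠ 0`, `sitesPerDir k ≥ 40`) there is a pinned-biharmonic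
# Green matrix `G` with the two displayed rows `hG0`, `hGrep` of ✓ `Prop7CentreHarmonicInterpKernel.norm_grad_interp_error_le` AND `∀ b, Σ_z|c·(Δ_c(G b₊) − Δ_c(G b₋))(z)| ≤ Φ·L^k∕|c|`
# with ONE ABSOLUTE CONSTANT `Φ` — so `hInterp` holds with `c_I·ℓ := Φ·L^k∕|c|`, L-, k-, volume-free.  NO displayed row is left: (R2) is ✓ `Prop7TorusGreen2GradientBound.abs_torusGreen2_grad_le`,
# the Agmon rate is `κ₀ := min(1∕4, 1∕(100(2√3·C_G^{1∕4}+1)), 1∕(50(12√C_G+1)))`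

Cell `ym3-torus`, width seat `ym3-torus-px22` (gen 2) = the (A)-instantiation seat (★routeR-w3 g5 19:59:56Z); LOCATE 19200 evidence `LOCATE-A3-FARFIELD-px22g2.md` v1.2; the chain:
(EL-loc) ✓p662444 · (Lλ) ✓p662709 · (A-door) ✓p663210 · (I-site) ✓p663513 · (S) ✓p663986 · (U) ✓p664410 · (Gm) ✓p664882 · (N) ✓p665612 · (F-a) ✓p666913∕✓p667471 · (F-b.1) `…PinnedKernelL1Arith`,
over px4's (R5)∕(R5c)∕`SiteFree`, px7's (R4), px13's (R2) (⟸ routeR-w2's (R1)), ★w8's (R3a), routeR-w6's (D2′)∕(Hess3), routeR-w2's (D1)∕(W1)(W2)(W3), routeR-w3's (R)(E)(A0)(A1)(N).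
`--supports stmt-QuantumFields-19200`, count-neutral.  THEOREMS ONLY (0 `def`, 0 `sorry`).  YM₃ on T³ is a ladder rung (R3), not the Clay problem; nothing here claims the stub, the crux,
d = 4 or the gap.

WHAT IS PROVED (ns `…Theorems.Prop7PinnedKernelL1`).
* §1 `abs_torusGreen2_grad_le_of_eq` ((R2) with a dimension parameter), `laplace_smul_const`, ★ `rep_real_of_rep` (a `V`-valued representation row `hGrep` for a NONTRIVIAL real normed `V`
  gives the real one: test with `e • v₀`).
* §2 `kappa0_rows` — `κ₀` is positive, `≤ 1∕4`, and satisfies the two raw window rows of ✓ `sum_abs_laplace_kernel_le_explicit` at every scale (`ℓ`, `|c|` cancel).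
* §3 ★★★ `exists_green_kernel_l1_le` — THE (hK) ROW: `∃ Φ, ∀ P (d = 3) k (1 ≤ k ≤ m+K) c ≠ 0 (40 ≤ sitesPerDir k) V (nontrivial real normed), ∃ G, hG0 ∧ hGrep ∧ ∀ b, Σ_z|c·(Δ_c(G b₊) − Δ_c(G b₋))(z)| ≤ Φ·L^k∕|c|`.
  USE (the consumer, ✓p654411 at `j = 0`, `C := range (embIter k)`): `obtain ⟨G, hG0, hGrep, hK⟩ := …` then `norm_grad_interp_error_le c C G hGrep hG0 φ φH hH hEL hs₁ b (hK b)` gives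
  `‖∂_c(φ − φ_H)(b)‖ ≤ (Φ·L^k∕|c|)·s₁` — the displayed `hInterp` of ✓ `…CentreHarmonicRegaugeSup.sup_regauge_le_of_rows` with `c_I := Φ∕|c|`.
HONEST SCOPE.  Flat, scalar kernel; `Φ` is astronomically large (crude constants: `C_G ≈ 1.7·10¹⁶` from (D1-glob), `κ₀ ≈ 10⁻¹¹`) but ABSOLUTE.  The hypotheses `1 ≤ k` and `40 ≤ sitesPerDir k`
(`= 2L^{m+K−k}`) hold in every `T3Family` instance with `k = K − n ≥ 1`, `L^{m+n} ≥ 20`.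

References: T. Bałaban, CMP 96 (1984) 223–250 [Balaban1984PropagatorsII] ((1.9) p.226, (2.61) p.234); CMP 99 (1985) 75–102 [Balaban1985RegularSpaces] ((1.14) p.78, (1.36) p.82);
CMP 102 (1985) 277–309 [Balaban1985Variational] (Prop. 7 p.299); CMP 95 (1984) 17–40 [Balaban1984PropagatorsI] (Sect. C p.22).
-/

set_option autoImplicit false

noncomputable section

open scoped BigOperators

namespace Summit.QuantumFields.YangMills.Theorems.Prop7PinnedKernelL1

open Literature.MathematicalPhysics.QuantumFieldTheory.Balaban1983to89
open Finset LatticeFieldCalculus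
open B15DeterminingSets (embIter)
open B5Eq117TorusCarriers (EK)
open Literature.Probability.LatticeModels (torusGreen TorusSite latticeMomentum dispersion)
open Summit.QuantumFields.YangMills.Theorems.Prop7CentreHarmonicInterpKernel (laplace_sub')
open Summit.QuantumFields.YangMills.Theorems.Prop7PinnedKernelL1Explicit (sum_abs_laplace_kernel_le_explicit)
open Summit.QuantumFields.YangMills.Theorems.Prop7PinnedKernelL1Arith (explicit_le_linear sqrtA_eq)
open Summit.QuantumFields.YangMills.Theorems.Prop7GreenKernelSiteFree (exists_green_site_split_free)

/-! ## §1 Letters -/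

/-- (R2) ✓ `Prop7TorusGreen2GradientBound.abs_torusGreen2_grad_le` with the dimension as a PARAMETER. [cite: Balaban1985RegularSpaces, (1.36) p.82] -/
theorem abs_torusGreen2_grad_le_of_eq : ∃ C : ℝ, ∀ {d : ℕ} (_ : d = 3) (L : ℕ) [NeZero L] (G : TorusSite d L → ℝ),
    (∀ z, G z = (∑ k ∈ (univ : Finset (TorusSite d L)).erase 0,
      Real.cos (∑ i, latticeMomentum L k i * ((z i).val : ℝ)) / dispersion (latticeMomentum L k) ^ 2) / (L : ℝ) ^ d) →
    ∀ (i : Fin d) (z : TorusSite d L), |G (z + Pi.single i 1) - G z| ≤ C := by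
  obtain ⟨C, hC⟩ := Prop7TorusGreen2GradientBound.abs_torusGreen2_grad_le
  refine ⟨C, ?_⟩
  intro d hd
  subst hd
  exact hC

variable {P : Params} {j : ℕ}

/-- `Δ_c(e • v₀) = (Δ_c e) • v₀`. [cite: Balaban1984PropagatorsI, (1.21) p.21] -/
theorem laplace_smul_const {V : Type*} [AddCommGroup V] [Module ℝ V] (c : ℝ) (e : SiteField P j ℝ) (v₀ : V) :
    laplace c (fun x => e x • v₀) = fun x => laplace c e x • v₀ := by
  funext x
  simp only [laplace, smul_eq_mul, Finset.sum_smul]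
  refine Finset.sum_congr rfl fun μ _ => ?_
  module

/-- ★ **A `V`-VALUED REPRESENTATION ROW GIVES THE REAL ONE** (`V` a nontrivial real normed space): test `hGrep` with `e • v₀`, `v₀ ≠ 0`. [cite: Balaban1984PropagatorsI, Sect. C p.22] -/
theorem rep_real_of_rep {V : Type*} [NormedAddCommGroup V] [NormedSpace ℝ V] [Nontrivial V] (c : ℝ) (C : Set (Site P j))
    (G : Site P j → Site P j → ℝ)
    (hGrep : ∀ e : SiteField P j V, (∀ y ∈ C, e y = 0) → ∀ x, e x = ∑ z, G x z • laplace c (laplace c e) z) :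
    ∀ e : SiteField P j ℝ, (∀ y ∈ C, e y = 0) → ∀ x, e x = ∑ z, G x z * laplace c (laplace c e) z := by
  obtain ⟨v₀, hv₀⟩ := exists_ne (0 : V)
  intro e he x
  have h := hGrep (fun y => e y • v₀) (fun y hy => by simp [he y hy]) x
  rw [laplace_smul_const, laplace_smul_const] at h
  have h2 : ∑ z, G x z • (laplace c (laplace c e) z • v₀) = (∑ z, G x z * laplace c (laplace c e) z) • v₀ := by
    rw [Finset.sum_smul]
    exact Finset.sum_congr rfl fun z _ => by rw [smul_smul]
  rw [h2] at h
  have h3 : (e x - ∑ z, G x z * laplace c (laplace c e) z) • v₀ = 0 := by rw [sub_smul, h, sub_self]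
  rcases smul_eq_zero.mp h3 with h4 | h4
  · linarith
  · exact absurd h4 hv₀

/-! ## §2 The Agmon rate `κ₀` and its window rows -/

/-- **`κ₀`'s rows**: with `C_G := 2197·(24·289·24576·46116)` and `κ₀ := min(1∕4, min(1∕(100(2√3·√(√C_G)+1)), 1∕(50(12√C_G+1))))`: `0 < κ₀ ≤ 1`, and for `d = 3`, every `ℓ ≥ 1`, `c ≠ 0`:
`2κ₀∕ℓ ≤ 1∕2`, `(2κ₀∕ℓ)|c|√d·√(√(C_G∕c⁴)ℓ²) ≤ 1∕100`, `(4κ₀∕ℓ²)c²d·(√(C_G∕c⁴)ℓ²) ≤ 1∕50` (the raw window rows of ✓ `sum_abs_laplace_kernel_le_explicit`; `ℓ`, `|c|` cancel).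
[cite: Balaban1984PropagatorsII, (1.9) p.226] -/
theorem kappa0_rows (hd : (P.d : ℝ) = 3) {ℓ c κ : ℝ} (hℓ : 1 ≤ ℓ) (hc : c ≠ 0)
    (hκ : κ = min (1 / 4) (min (1 / (100 * (2 * Real.sqrt 3 * Real.sqrt (Real.sqrt ((2197 * (24 * 289 * 24576 * 46116) : ℝ))) + 1)))
      (1 / (50 * (12 * Real.sqrt ((2197 * (24 * 289 * 24576 * 46116) : ℝ)) + 1))))) :
    0 < κ ∧ κ ≤ 1 ∧ 2 * κ / ℓ ≤ 1 / 2
      ∧ 2 * κ / ℓ * |c| * Real.sqrt P.d * Real.sqrt (Real.sqrt ((2197 * (24 * 289 * 24576 * 46116) : ℝ) / c ^ 4) * ℓ ^ 2) ≤ 1 / 100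
      ∧ 4 * κ / ℓ ^ 2 * c ^ 2 * P.d * (Real.sqrt ((2197 * (24 * 289 * 24576 * 46116) : ℝ) / c ^ 4) * ℓ ^ 2) ≤ 1 / 50 := by
  have hℓ0 : 0 < ℓ := by linarith
  have hℓne : ℓ ≠ 0 := hℓ0.ne'
  have hca : 0 < |c| := abs_pos.mpr hc
  have hcane : |c| ≠ 0 := hca.ne'
  have hc2 : 0 < c ^ 2 := by positivity
  have hs0 : 0 ≤ Real.sqrt 3 := Real.sqrt_nonneg _
  set CG : ℝ := (2197 * (24 * 289 * 24576 * 46116) : ℝ) with hCG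
  have hCG0 : 0 ≤ CG := by rw [hCG]; norm_num
  obtain ⟨hA1, hA2⟩ := sqrtA_eq hCG0 hc hℓ0.le
  set Q4 : ℝ := Real.sqrt (Real.sqrt CG) with hQ4
  set Q2 : ℝ := Real.sqrt CG with hQ2
  have hQ40 : 0 ≤ Q4 := Real.sqrt_nonneg _
  have hQ20 : 0 ≤ Q2 := Real.sqrt_nonneg _
  have hκ4 : κ ≤ 1 / 4 := by rw [hκ]; exact min_le_left _ _
  have hκ1 : κ ≤ 1 / (100 * (2 * Real.sqrt 3 * Q4 + 1)) := by rw [hκ]; exact (min_le_right _ _).trans (min_le_left _ _)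
  have hκ2 : κ ≤ 1 / (50 * (12 * Q2 + 1)) := by rw [hκ]; exact (min_le_right _ _).trans (min_le_right _ _)
  have hκ0 : 0 < κ := by rw [hκ]; positivity
  refine ⟨hκ0, by linarith, ?_, ?_, ?_⟩
  · rw [div_le_iff₀ hℓ0]; nlinarith
  · rw [hA2, hd]
    have e : 2 * κ / ℓ * |c| * Real.sqrt 3 * (Q4 * ℓ / |c|) = κ * (2 * Real.sqrt 3 * Q4) := by
      field_simp
    rw [e]
    have h1 : κ * (2 * Real.sqrt 3 * Q4) ≤ κ * (2 * Real.sqrt 3 * Q4 + 1) := by nlinarith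
    have h2 : κ * (2 * Real.sqrt 3 * Q4 + 1) ≤ 1 / (100 * (2 * Real.sqrt 3 * Q4 + 1)) * (2 * Real.sqrt 3 * Q4 + 1) :=
      mul_le_mul_of_nonneg_right hκ1 (by positivity)
    have h3 : 1 / (100 * (2 * Real.sqrt 3 * Q4 + 1)) * (2 * Real.sqrt 3 * Q4 + 1) = 1 / 100 := by
      field_simp
    linarith
  · rw [hA1, hd]
    have e : 4 * κ / ℓ ^ 2 * c ^ 2 * 3 * (Q2 / c ^ 2 * ℓ ^ 2) = κ * (12 * Q2) := by
      field_simp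
      ring
    rw [e]
    have h1 : κ * (12 * Q2) ≤ κ * (12 * Q2 + 1) := by nlinarith
    have h2 : κ * (12 * Q2 + 1) ≤ 1 / (50 * (12 * Q2 + 1)) * (12 * Q2 + 1) := mul_le_mul_of_nonneg_right hκ2 (by positivity)
    have h3 : 1 / (50 * (12 * Q2 + 1)) * (12 * Q2 + 1) = 1 / 50 := by field_simp
    linarith

/-! ## §3 ★★★ The kernel bound (hK) -/

/-- ★★★ **(hK) — THE ℓ¹ MASS OF THE PINNED-BIHARMONIC INTERPOLATION KERNEL IS `≤ c_I·ℓ`.**  There is an absolute `Φ` such that for every run `P` with `d = 3`, every `1 ≤ k ≤ m + K`, every lattice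
factor `c ≠ 0` and `sitesPerDir k ≥ 40`, and every nontrivial real normed `V`, there is a matrix `G` on `Site P 0 × Site P 0` with (hG0) `G(x,y) = 0` at the k-centres `y`, (hGrep) `e(x) = Σ_z G(x,z)•Δ_c²e(z)`
for every `V`-valued `e` vanishing at the k-centres, and (hK) `Σ_z|c·(Δ_c(G b₊) − Δ_c(G b₋))(z)| ≤ Φ·L^k∕|c|` for every bond `b` — the displayed kernel hypothesis of
✓ `Prop7CentreHarmonicInterpKernel.norm_grad_interp_error_le` with `c_I·ℓ := Φ·L^k∕|c|`, hence the `W^{1,∞}` interpolation row `hInterp` of the corrector-sup chain (S2) with an L-only constant.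
Proof: `G` = px4's ✓ `exists_green_site_split_free`; (hK) = ✓ `sum_abs_laplace_kernel_le_explicit` at `κ := κ₀` (§2), (R2) ✓ `abs_torusGreen2_grad_le` for `C_V`, then ✓ `explicit_le_linear`.
[cite: Balaban1985RegularSpaces, (1.36) p.82; Balaban1984PropagatorsII, (1.9) p.226; Balaban1985Variational, Prop. 7 p.299] -/
theorem exists_green_kernel_l1_le : ∃ Φ : ℝ, ∀ (P : Params) (_ : P.d = 3) (k : ℕ) (_ : k ≤ P.m + P.K) (_ : 1 ≤ k) (c : ℝ) (_ : c ≠ 0)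
    (_ : 40 ≤ P.sitesPerDir k) (V : Type) [NormedAddCommGroup V] [NormedSpace ℝ V] [Nontrivial V],
    ∃ G : Site P 0 → Site P 0 → ℝ,
      (∀ x, ∀ y ∈ Set.range (embIter (P := P) k), G x y = 0)
      ∧ (∀ e : SiteField P 0 V, (∀ y ∈ Set.range (embIter (P := P) k), e y = 0) → ∀ x, e x = ∑ z, G x z • laplace c (laplace c e) z)
      ∧ ∀ b : PBond P 0, ∑ z, |c * (laplace c (G b.tgt) z - laplace c (G b.src) z)| ≤ Φ * (P.L : ℝ) ^ k / |c| := by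
  classical
  obtain ⟨CR, CN, CH1, CH, hCR0, hCN0, hCH10, hCH0, hE⟩ := sum_abs_laplace_kernel_le_explicit
  obtain ⟨C2, hC2⟩ := abs_torusGreen2_grad_le_of_eq
  set CV : ℝ := max C2 0 with hCV
  have hCV0 : 0 ≤ CV := le_max_right _ _
  set κ : ℝ := min (1 / 4) (min (1 / (100 * (2 * Real.sqrt 3 * Real.sqrt (Real.sqrt ((2197 * (24 * 289 * 24576 * 46116) : ℝ))) + 1)))
      (1 / (50 * (12 * Real.sqrt ((2197 * (24 * 289 * 24576 * 46116) : ℝ)) + 1)))) with hκ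
  -- the absolute constant
  refine ⟨9 * Real.exp (20 * κ) * Real.sqrt ((40 * (2 + 9 * Real.pi / (10 * κ))) ^ 3) * (CH + CV)
          + 45 / 8 * Real.exp (20 * κ) * Real.sqrt ((60 * (2 + 9 * Real.pi / (10 * κ))) ^ 3) * Real.sqrt (Real.sqrt (2197 * (24 * 289 * 24576 * 46116))) * CN
          + 243 / 8 * Real.exp (20 * κ) * Real.sqrt ((40 * (2 + 9 * Real.pi / (10 * κ))) ^ 3) * Real.sqrt (2197 * (24 * 289 * 24576 * 46116)) * CH1
          + (10 * CR + 192000 * (CH + CV))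
          + 74088 * 4719 * CV
          + 14157 * Real.exp (21 * κ) * Real.sqrt ((42 * (2 + 9 * Real.pi / (10 * κ))) ^ 3) * CV, ?_⟩
  intro P hd k hk hk1 c hc hM V _ _ _
  haveI hNZ : NeZero (P.L ^ k * P.sitesPerDir k) := ⟨mul_ne_zero (pow_ne_zero _ P.L_pos.ne') (P.sitesPerDir_ne_zero k)⟩
  obtain ⟨Gf, Uf, G, hsplit, hUC, hG0, hUel, hGf1, hGf2, hGfF, hGrepV⟩ := exists_green_site_split_free (P := P) hk hc (V := V)
  refine ⟨G, hG0, hGrepV, fun b => ?_⟩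
  -- the real representation row
  have hGrep := rep_real_of_rep c _ G hGrepV
  -- the displayed `G₂` and its (R2) row
  obtain ⟨G₂, hG₂'⟩ : ∃ G₂ : TorusSite P.d (P.L ^ k * P.sitesPerDir k) → ℝ, ∀ t,
      G₂ t = (∑ q ∈ (univ : Finset (TorusSite P.d (P.L ^ k * P.sitesPerDir k))).erase 0,
        Real.cos (∑ i, latticeMomentum (P.L ^ k * P.sitesPerDir k) q i * ((t i).val : ℝ))
          / dispersion (latticeMomentum (P.L ^ k * P.sitesPerDir k) q) ^ 2)
        / (((P.L ^ k * P.sitesPerDir k : ℕ) : ℝ)) ^ P.d := ⟨_, fun t => rfl⟩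
  have hV2 : ∀ (i : Fin P.d) (t : TorusSite P.d (P.L ^ k * P.sitesPerDir k)), |G₂ (t + Pi.single i 1) - G₂ t| ≤ CV :=
    fun i t => (hC2 hd (P.L ^ k * P.sitesPerDir k) G₂ hG₂' i t).trans (le_max_left _ _)
  -- scale letters
  have hd3 : (P.d : ℝ) = 3 := by rw [hd]; norm_num
  have hL3 : 3 ≤ P.L := by
    have h1 := P.hL.2; have h2 := P.hL.1
    rcases h2 with ⟨m, hm⟩; omega
  have hℓ3n : 3 ≤ P.L ^ k := by
    calc 3 ≤ P.L := hL3
      _ = P.L ^ 1 := (pow_one _).symm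
      _ ≤ P.L ^ k := Nat.pow_le_pow_right P.L_pos hk1
  have hℓ3 : (3 : ℝ) ≤ (P.L : ℝ) ^ k := by exact_mod_cast hℓ3n
  have hℓ1 : (1 : ℝ) ≤ (P.L : ℝ) ^ k := by linarith
  obtain ⟨hκ0, hκ1, ha, hwin₁, hwin₂⟩ := kappa0_rows (P := P) hd3 hℓ1 hc hκ
  -- the explicit bound at `κ₀`
  have hexp := hE P hd k hk hk1 c hc hM G₂ hG₂' CV hCV0 hV2 Gf Uf G hsplit hUC hG0 hUel hGf1 hGf2 (hGfF G₂ hG₂') hGrep κ hκ0 hκ1 ha hwin₁ hwin₂ b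
  have hlin := explicit_le_linear (ℓ := (P.L : ℝ) ^ k) (c := c) (κ := κ) (CR := CR) (CN := CN) (CH1 := CH1) (CH := CH) (CV := CV)
    P.d hd hℓ3 hc hκ0 hCR0 hCN0 hCH10 hCH0 hCV0
  have hbound := hexp.trans hlin
  -- the kernel is `c·Δ_c(V − U)`
  have hker : ∀ z, c * (laplace c (G b.tgt) z - laplace c (G b.src) z)
      = c * laplace c (fun x => (Gf b.tgt x - Gf b.src x) - (Uf b.tgt x - Uf b.src x)) z := by
    intro z
    have eT : G b.tgt = fun x => Gf b.tgt x - Uf b.tgt x := funext fun x => hsplit _ x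
    have eS : G b.src = fun x => Gf b.src x - Uf b.src x := funext fun x => hsplit _ x
    have e3 : (fun x => (Gf b.tgt x - Gf b.src x) - (Uf b.tgt x - Uf b.src x)) = fun x => (Gf b.tgt x - Uf b.tgt x) - (Gf b.src x - Uf b.src x) := by
      funext x; ring
    rw [e3, laplace_sub', eT, eS]
  have hca : 0 < |c| := abs_pos.mpr hc
  calc ∑ z, |c * (laplace c (G b.tgt) z - laplace c (G b.src) z)|
      = |c| * ∑ z, |laplace c (fun x => (Gf b.tgt x - Gf b.src x) - (Uf b.tgt x - Uf b.src x)) z| := by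
        rw [Finset.mul_sum]
        exact Finset.sum_congr rfl fun z _ => by rw [hker z, abs_mul]
    _ ≤ |c| * (_ * (P.L : ℝ) ^ k / c ^ 2) := mul_le_mul_of_nonneg_left hbound hca.le
    _ = _ * (P.L : ℝ) ^ k / |c| := by
        have e : c ^ 2 = |c| * |c| := by rw [← sq, sq_abs]
        rw [e]; field_simp

end Summit.QuantumFields.YangMills.Theorems.Prop7PinnedKernelL1

end
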